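import Mathlib
import Literature.Computability.AlgebraicComplexity.EquivariantDC
import Literature.Computability.AlgebraicComplexity.StandardFamilies
import Summits.ValiantsHypothesis.ValiantsHypothesis.Theorems.SymPencilSymmetrizePermPairsRegularPermify
import HarnessLib

/-!
# ValiantsHypothesis / SymPencil — crux `SymmetrizePermPairs` (stmt-ValiantsHypothesis-17793),
# line `birth_SymmetrizePermPairs`, stub `stub_induce`, piece (I2) in the stub's own currency:
# a subgroup `Γ' ≤ Γ_n` of `GL(n², ℂ)` and its index

The registered stub `stub_induce` quantifies over a subgroup `Γ' ≤ permPairSubst n = Γ_n`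
(`Γ_n` = the closure of the permutation matrices of `Equiv.prodCongr π ρ`) and measures its budget
by the relative index `R = Γ'.relIndex Γ_n`.  Piece (I2) was landed over a subgroup
`H ≤ 𝔖_n × 𝔖_n` of PAIRS (`permify_regular_of_subgroup(_qp)`, `…RegularPermify.lean`).  This file
is the bookkeeping between the two currencies, so that (I2) plugs into the stub's binders verbatim
(`permify_regular_of_le_permPairSubst`): the pair homomorphism `θ (π, ρ) = P_{(π × ρ)⁻¹}`
(`Matrix.permMatrixHom`, made unit-valued) has range `Γ_n`, `H := θ⁻¹(Γ')` has index
`[𝔖_n × 𝔖_n : H] = Γ'.relIndex Γ_n` (`Subgroup.index_comap`), `Γ'`-equivariance restricts to the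
closure of the pair matrices of `H` (`IsEquivariantDetRepr.anti`), and every `γ ∈ Γ'` is `θ` of a
pair of `H`, acting on polynomials by `rename` (`linSubst_permMatrix`).

Result: for `Γ' ≤ Γ_n` with `(n!)² ≤ 2^{(log₂ R)²}` (the large-index regime) and a `Γ'`-equivariant
affine determinantal representation `A` of `per_n` of size `m`, there is an affine pencil `A'` of
size `m' ≤ 2^{(log₂ (m R + m) + 2)²}` with `det A' = per_n` such that every `γ ∈ Γ'` acts on `A'`
by conjugation with a permutation matrix, `A'(γ · x) = P_σ A'(x) P_σᵀ` — the budget of `stub_induce`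
with `d = 2`, but permutation lifts over `Γ'` only (not `Γ_n`-equivariance, not symmetry: those are
the cores (I1)/(C3) of the sizing note, untouched).

Honest framing: helper layer for an OPEN stub of an OPEN crux; `VP ≠ VNP` is NOT proved and nothing
here is progress on it.  No new definitions, no named facts
(`--supports stmt-ValiantsHypothesis-17793 --as helper`).
-/

noncomputable section

-- `Summit.ValiantsHypothesis.ValiantsHypothesis.…` is the tree's mandated single-conjunct layout
-- (Sub = Summit), so the duplicated namespace component is intended.
set_option linter.dupNamespace false

namespace Summit.ValiantsHypothesis.ValiantsHypothesis.Theorems.SymPencilEquivariantSdcNotQP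

open Literature.Computability.AlgebraicComplexity MvPolynomial Matrix

/-- **(I2) in the currency of `stub_induce`.**  Let `Γ' ≤ Γ_n` (`Γ_n` spelled VERBATIM as the
line file's `permPairSubst n`) with relative index `R = Γ'.relIndex Γ_n` in the large-index regime
`(n!)² ≤ 2^{(log₂ R)²}`, and let `A` be a `Γ'`-equivariant affine determinantal representation of
`per_n` of size `m` (exact `GL_m × GL_m` lifts, tree `IsEquivariantDetRepr`).  Then there is an
affine pencil `A'` of size `m' ≤ 2^{(log₂ (m R + m) + 2)²}` with `det A' = per_n` on which
(1) every substitution `x_{ij} ↦ x_{π i, ρ j}` whose permutation matrix `P_{π × ρ}` underlies an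
element of `Γ'`, and (2) every `γ ∈ Γ'` itself (tree action `Matrix.linSubstEntries`), acts by
conjugation with a PERMUTATION matrix.  Proof: `permify_regular_of_subgroup_qp` for
`H = θ⁻¹(Γ')`, `θ (π, ρ) = P_{(π × ρ)⁻¹}` the pair homomorphism, whose range is `Γ_n`. [folklore] -/
theorem permify_regular_of_le_permPairSubst (n m : ℕ) (Γ' : Subgroup (GL (Fin n × Fin n) ℂ))
    (hle : Γ' ≤ Subgroup.closure {γ : GL (Fin n × Fin n) ℂ | ∃ π ρ : Equiv.Perm (Fin n),
      (γ : Matrix (Fin n × Fin n) (Fin n × Fin n) ℂ) = Equiv.Perm.permMatrix ℂ (Equiv.prodCongr π ρ)})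
    (hbig : (Nat.factorial n) ^ 2 ≤ 2 ^ ((Nat.log 2 (Γ'.relIndex
      (Subgroup.closure {γ : GL (Fin n × Fin n) ℂ | ∃ π ρ : Equiv.Perm (Fin n),
        (γ : Matrix (Fin n × Fin n) (Fin n × Fin n) ℂ) =
          Equiv.Perm.permMatrix ℂ (Equiv.prodCongr π ρ)}))) ^ 2))
    (A : Matrix (Fin m) (Fin m) (MvPolynomial (Fin n × Fin n) ℂ))
    (hA : IsEquivariantDetRepr Γ' (perPoly (Fin n) ℂ) A) :
    ∃ m' ≤ 2 ^ ((Nat.log 2 (m * Γ'.relIndex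
        (Subgroup.closure {γ : GL (Fin n × Fin n) ℂ | ∃ π ρ : Equiv.Perm (Fin n),
          (γ : Matrix (Fin n × Fin n) (Fin n × Fin n) ℂ) =
            Equiv.Perm.permMatrix ℂ (Equiv.prodCongr π ρ)}) + m) + 2) ^ 2),
      ∃ A' : Matrix (Fin m') (Fin m') (MvPolynomial (Fin n × Fin n) ℂ),
        IsAffineDetRepr (perPoly (Fin n) ℂ) A' ∧
        (∀ π ρ : Equiv.Perm (Fin n),
          (∃ γ ∈ Γ', (γ : Matrix (Fin n × Fin n) (Fin n × Fin n) ℂ) =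
            Equiv.Perm.permMatrix ℂ (Equiv.prodCongr π ρ)) →
          ∃ σ : Equiv.Perm (Fin m'),
            A'.map (MvPolynomial.rename fun ij : Fin n × Fin n => (π ij.1, ρ ij.2)) =
              (σ.permMatrix ℂ).map MvPolynomial.C * A' * ((σ.permMatrix ℂ)ᵀ).map MvPolynomial.C) ∧
        (∀ γ ∈ Γ', ∃ σ : Equiv.Perm (Fin m'),
          Matrix.linSubstEntries γ A' =
            (σ.permMatrix ℂ).map MvPolynomial.C * A' * ((σ.permMatrix ℂ)ᵀ).map MvPolynomial.C) := by
  classical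
  -- the pair homomorphism `θ (π, ρ) = P_{(π × ρ)⁻¹}` into `GL(n², ℂ)`
  let θ₀ : Equiv.Perm (Fin n) × Equiv.Perm (Fin n) →* Equiv.Perm (Fin n × Fin n) :=
    { toFun := fun πρ => Equiv.prodCongr πρ.1 πρ.2
      map_one' := by ext ⟨i, j⟩ <;> rfl
      map_mul' := fun a b => by ext ⟨i, j⟩ <;> rfl }
  let θ : Equiv.Perm (Fin n) × Equiv.Perm (Fin n) →* GL (Fin n × Fin n) ℂ :=
    (Matrix.permMatrixHom (n := Fin n × Fin n) (R := ℂ)).toHomUnits.comp θ₀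
  have hθinv : ∀ πρ : Equiv.Perm (Fin n) × Equiv.Perm (Fin n),
      (((θ πρ)⁻¹ : GL (Fin n × Fin n) ℂ) : Matrix (Fin n × Fin n) (Fin n × Fin n) ℂ) =
        Equiv.Perm.permMatrix ℂ (Equiv.prodCongr πρ.1 πρ.2) := fun πρ => rfl
  have hθ : ∀ πρ : Equiv.Perm (Fin n) × Equiv.Perm (Fin n),
      ((θ πρ : GL (Fin n × Fin n) ℂ) : Matrix (Fin n × Fin n) (Fin n × Fin n) ℂ) =
        Equiv.Perm.permMatrix ℂ (Equiv.prodCongr πρ.1 πρ.2)⁻¹ := fun πρ => rfl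
  -- from a matrix identity to an identity in `GL`
  have hunit : ∀ (πρ : Equiv.Perm (Fin n) × Equiv.Perm (Fin n)) (γ : GL (Fin n × Fin n) ℂ),
      (γ : Matrix (Fin n × Fin n) (Fin n × Fin n) ℂ) =
        Equiv.Perm.permMatrix ℂ (Equiv.prodCongr πρ.1 πρ.2) → θ πρ = γ⁻¹ := by
    intro πρ γ hγ
    rw [← _root_.inv_inj, inv_inv]
    exact Units.ext (by rw [hθinv]; exact hγ.symm)
  -- `Γ_n` is the range of `θ`
  have hrange : Subgroup.closure {γ : GL (Fin n × Fin n) ℂ | ∃ π ρ : Equiv.Perm (Fin n),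
      (γ : Matrix (Fin n × Fin n) (Fin n × Fin n) ℂ) =
        Equiv.Perm.permMatrix ℂ (Equiv.prodCongr π ρ)} = θ.range := by
    apply le_antisymm
    · rw [Subgroup.closure_le]
      rintro γ ⟨π, ρ, hγ⟩
      refine ⟨(π, ρ)⁻¹, ?_⟩
      rw [map_inv, hunit (π, ρ) γ hγ, inv_inv]
    · rintro γ ⟨πρ, rfl⟩
      refine Subgroup.subset_closure ⟨πρ.1⁻¹, πρ.2⁻¹, ?_⟩
      have he : (Equiv.prodCongr πρ.1 πρ.2)⁻¹ = Equiv.prodCongr πρ.1⁻¹ πρ.2⁻¹ :=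
        Equiv.ext fun _ => rfl
      rw [hθ, he]
  -- the subgroup of pairs and its index
  set H : Subgroup (Equiv.Perm (Fin n) × Equiv.Perm (Fin n)) := Γ'.comap θ with hH
  have hmemH : ∀ πρ, πρ ∈ H ↔ θ πρ ∈ Γ' := fun πρ => by rw [hH, Subgroup.mem_comap]
  have hHindex : H.index = Γ'.relIndex (Subgroup.closure {γ : GL (Fin n × Fin n) ℂ |
      ∃ π ρ : Equiv.Perm (Fin n), (γ : Matrix (Fin n × Fin n) (Fin n × Fin n) ℂ) =
        Equiv.Perm.permMatrix ℂ (Equiv.prodCongr π ρ)}) := by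
    rw [hH, Subgroup.index_comap, ← hrange]
  -- `Γ'`-equivariance restricts to the closure of the pair matrices of `H`
  have hleH : Subgroup.closure {γ : GL (Fin n × Fin n) ℂ |
      ∃ πρ ∈ H, (γ : Matrix (Fin n × Fin n) (Fin n × Fin n) ℂ) =
        Equiv.Perm.permMatrix ℂ (Equiv.prodCongr πρ.1 πρ.2)} ≤ Γ' := by
    rw [Subgroup.closure_le]
    rintro γ ⟨πρ, hπρ, hγ⟩
    have h1 : γ = (θ πρ)⁻¹ := by rw [hunit πρ γ hγ, inv_inv]
    rw [SetLike.mem_coe, h1]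
    exact Γ'.inv_mem ((hmemH πρ).mp hπρ)
  have hAH := hA.anti hleH
  have hHcard := card_le_budget_of_factorial_sq_le H (by rwa [hHindex])
  obtain ⟨m', hm', A', hA', hperm⟩ := permify_regular_of_subgroup_qp n m H hHcard A hAH
  rw [hHindex] at hm'
  refine ⟨m', hm', A', hA', fun π ρ hπρ => ?_, fun γ hγ => ?_⟩
  · -- (1): the pair lies in `H`
    obtain ⟨γ, hγ, hγe⟩ := hπρ
    refine hperm (π, ρ) ((hmemH _).mpr ?_)
    rw [hunit (π, ρ) γ hγe]
    exact Γ'.inv_mem hγ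
  · -- (2): `γ = θ (π, ρ)` for a pair of `H`, acting by `rename (π × ρ)`
    obtain ⟨πρ, hπρ⟩ : γ ∈ θ.range := by rw [← hrange]; exact hle hγ
    have hmem : πρ ∈ H := (hmemH πρ).mpr (by rw [hπρ]; exact hγ)
    obtain ⟨σ, hσ⟩ := hperm πρ hmem
    refine ⟨σ, ?_⟩
    rw [← hσ, ← hπρ]
    change A'.map (linSubst (Fin n × Fin n) ℂ
      ((θ πρ : GL (Fin n × Fin n) ℂ) : Matrix (Fin n × Fin n) (Fin n × Fin n) ℂ)) = _
    rw [hθ, linSubst_permMatrix]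
    have hfun : (⇑((Equiv.prodCongr πρ.1 πρ.2)⁻¹).symm : Fin n × Fin n → Fin n × Fin n) =
        fun ij => (πρ.1 ij.1, πρ.2 ij.2) := by
      funext ij
      rfl
    rw [hfun]

end Summit.ValiantsHypothesis.ValiantsHypothesis.Theorems.SymPencilEquivariantSdcNotQP

end
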